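import Mathlib.MeasureTheory.Integral.IntervalIntegral.Basic
import Mathlib.Analysis.SpecialFunctions.Pow.Continuity
import Mathlib.Analysis.SpecialFunctions.Pow.Real
import Summits.FinalStateConjecture.FinalStateConjecture.Theorems.EIHFluxBalanceInertialRecessionStaircaseGap
import Summits.FinalStateConjecture.FinalStateConjecture.Theorems.EIHFluxBalanceInertialRecessionStaircaseScales
import Summits.FinalStateConjecture.FinalStateConjecture.Theorems.EIHFluxBalanceInertialRecessionStaircaseCover

/-!
# Route EIHFluxBalance — crux `InertialRecession` (E′), line `SketchCleanExcision`:
# the staircase, part 5 — cover facts, the error envelope `ζ₀`, and the flux-integrand arithmetic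

Helper file for the crux `stmt-FinalStateConjecture-17403`
(`Summit.FinalStateConjecture.FinalStateConjecture.Theses.EIHFluxBalance.InertialRecession`), registered stub
`stub_integratedClusterBalance` (skeleton r12, `Cruxes/InertialRecession/Lines/SketchCleanExcision.lean`).

* `cover_facts` — assembles parts 1–3: for a cover built from a gap scale `σ` of `S` at `s₀` (ceiling
  `16σ ≤ isol`) and an observation time `s ∈ [s₀, s₀ + σ/4]` above the threshold, every window is in the middle
  cone, admissible with clearance `1/8`, and its member set is its class; `threshold_main` /
  `threshold_refinement` — the covers of the staircase are above the threshold `ρ = c_ρ·gsc`.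
* `exists_envelope` — from `ζ → 0`: a non-increasing-in-effect envelope `Z ≥ 0`, `Z → 0`, dominating `ζ⁺` on
  every tail `[t, ∞)` after a time `T_Z`.
* `integrand_lower`, `static_le_integral`, `switch_le_integral` — the arithmetic turning the static cost
  `(s − s₀)·((4σ)^{3/2})⁻¹` and the switch cost `(√(4σ_r))⁻¹` (full step `s − s₀ = σ/4`, `σ_r ≥ λ²σ`) into
  multiples of `(s − s₀)·((Aσ)^{3/2})⁻¹`, the lower Riemann bound of `∫ (min (r s) s)^{-3/2}` over the step.
Mathlib only (plus parts 1–3). [folklore]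
-/

noncomputable section

set_option linter.dupNamespace false

open scoped BigOperators Classical Topology
open Finset Filter MeasureTheory intervalIntegral

namespace Summit.FinalStateConjecture.FinalStateConjecture.Theorems.SublinearIsFree.Staircase

open Literature.Geometry.Lorentzian


variable {N : ℕ}

/-! ### Cover facts during one step -/

/-- **COVER FACTS.** See the module docstring. [folklore] -/
theorem cover_facts {ξ : Fin N → ℝ → E3} {κ T c₀ : ℝ} {ρ : ℝ → ℝ} (hκ : 0 < κ) (hκ1 : κ < 1) (hT0 : 0 ≤ T)
    (hcone : ∀ i s, T ≤ s → ‖ξ i s‖ ≤ κ ^ 2 * s)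
    (hlip : ∀ i s s', T ≤ s → T ≤ s' → ‖ξ i s - ξ i s'‖ ≤ 2 * |s - s'|)
    (hc₀ : c₀ = (κ - κ ^ 2) / 2)
    {S : Finset (Fin N)} {s₀ s σ : ℝ} (hTs₀ : T ≤ s₀) (hs : s₀ ≤ s) (hs' : s ≤ s₀ + σ / 4) (hσ : 0 < σ)
    (hgap : ∀ i ∈ S, ∀ j ∈ S, ‖ξ i s₀ - ξ j s₀‖ < σ ∨ 16 * σ ≤ ‖ξ i s₀ - ξ j s₀‖)
    (hσiso : 16 * σ ≤ (Finset.fold min (c₀ * s₀) (fun pp ↦ ‖ξ (Prod.fst pp) s₀ - ξ (Prod.snd pp) s₀‖) (S ×ˢ Sᶜ))) (hthr : ρ s ≤ 1 / 8 * (4 * σ)) :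
    (∀ p ∈ (Finset.image (fun ii ↦ (dite (Finset.Nonempty (Finset.filter (fun jj ↦ ‖ξ ii s₀ - ξ jj s₀‖ < σ) S)) (fun hh ↦ Finset.min' (Finset.filter (fun jj ↦ ‖ξ ii s₀ - ξ jj s₀‖ < σ) S) hh) (fun _ ↦ ii))) S), ρ s ≤ 1 / 8 * (4 * σ) ∧ ‖ξ p s₀‖ + 4 * σ ≤ (κ + κ ^ 2) / 2 * s ∧
        ∀ j, ‖ξ j s - ξ p s₀‖ ≤ (1 - 1 / 8) * (4 * σ) ∨ (1 + 1 / 8) * (4 * σ) ≤ ‖ξ j s - ξ p s₀‖) ∧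
    (∀ p ∈ (Finset.image (fun ii ↦ (dite (Finset.Nonempty (Finset.filter (fun jj ↦ ‖ξ ii s₀ - ξ jj s₀‖ < σ) S)) (fun hh ↦ Finset.min' (Finset.filter (fun jj ↦ ‖ξ ii s₀ - ξ jj s₀‖ < σ) S) hh) (fun _ ↦ ii))) S), ∀ j, j ∈ S.filter (fun j ↦ (dite (Finset.Nonempty (Finset.filter (fun jj ↦ ‖ξ j s₀ - ξ jj s₀‖ < σ) S)) (fun hh ↦ Finset.min' (Finset.filter (fun jj ↦ ‖ξ j s₀ - ξ jj s₀‖ < σ) S) hh) (fun _ ↦ j)) = p) ↔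
        ‖ξ j s - ξ p s₀‖ ≤ (1 - 1 / 8) * (4 * σ)) ∧
    (∀ p ∈ (Finset.image (fun ii ↦ (dite (Finset.Nonempty (Finset.filter (fun jj ↦ ‖ξ ii s₀ - ξ jj s₀‖ < σ) S)) (fun hh ↦ Finset.min' (Finset.filter (fun jj ↦ ‖ξ ii s₀ - ξ jj s₀‖ < σ) S) hh) (fun _ ↦ ii))) S), ∀ j, ‖ξ j s - ξ p s₀‖ ≤ (1 - 1 / 8) * (4 * σ) →
        j ∈ S ∧ (dite (Finset.Nonempty (Finset.filter (fun jj ↦ ‖ξ j s₀ - ξ jj s₀‖ < σ) S)) (fun hh ↦ Finset.min' (Finset.filter (fun jj ↦ ‖ξ j s₀ - ξ jj s₀‖ < σ) S) hh) (fun _ ↦ j)) = p) ∧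
    (∀ j ∈ S, ∀ p ∈ (Finset.image (fun ii ↦ (dite (Finset.Nonempty (Finset.filter (fun jj ↦ ‖ξ ii s₀ - ξ jj s₀‖ < σ) S)) (fun hh ↦ Finset.min' (Finset.filter (fun jj ↦ ‖ξ ii s₀ - ξ jj s₀‖ < σ) S) hh) (fun _ ↦ ii))) S), (dite (Finset.Nonempty (Finset.filter (fun jj ↦ ‖ξ j s₀ - ξ jj s₀‖ < σ) S)) (fun hh ↦ Finset.min' (Finset.filter (fun jj ↦ ‖ξ j s₀ - ξ jj s₀‖ < σ) S) hh) (fun _ ↦ j)) = p → ‖ξ j s - ξ p s₀‖ ≤ 3 * σ / 2) := by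
  -- the inputs of part 3
  have hRpS : (Finset.image (fun ii ↦ (dite (Finset.Nonempty (Finset.filter (fun jj ↦ ‖ξ ii s₀ - ξ jj s₀‖ < σ) S)) (fun hh ↦ Finset.min' (Finset.filter (fun jj ↦ ‖ξ ii s₀ - ξ jj s₀‖ < σ) S) hh) (fun _ ↦ ii))) S) ⊆ S := reps_subset hσ
  have hclose : ∀ j ∈ S, ∀ p ∈ (Finset.image (fun ii ↦ (dite (Finset.Nonempty (Finset.filter (fun jj ↦ ‖ξ ii s₀ - ξ jj s₀‖ < σ) S)) (fun hh ↦ Finset.min' (Finset.filter (fun jj ↦ ‖ξ ii s₀ - ξ jj s₀‖ < σ) S) hh) (fun _ ↦ ii))) S), (dite (Finset.Nonempty (Finset.filter (fun jj ↦ ‖ξ j s₀ - ξ jj s₀‖ < σ) S)) (fun hh ↦ Finset.min' (Finset.filter (fun jj ↦ ‖ξ j s₀ - ξ jj s₀‖ < σ) S) hh) (fun _ ↦ j)) = p → ‖ξ j s₀ - ξ p s₀‖ < σ :=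
    fun j hj p hp h ↦ norm_sub_lt_of_rep_eq hσ hgap hj hp h
  have hfar : ∀ j ∈ S, ∀ p ∈ (Finset.image (fun ii ↦ (dite (Finset.Nonempty (Finset.filter (fun jj ↦ ‖ξ ii s₀ - ξ jj s₀‖ < σ) S)) (fun hh ↦ Finset.min' (Finset.filter (fun jj ↦ ‖ξ ii s₀ - ξ jj s₀‖ < σ) S) hh) (fun _ ↦ ii))) S), (dite (Finset.Nonempty (Finset.filter (fun jj ↦ ‖ξ j s₀ - ξ jj s₀‖ < σ) S)) (fun hh ↦ Finset.min' (Finset.filter (fun jj ↦ ‖ξ j s₀ - ξ jj s₀‖ < σ) S) hh) (fun _ ↦ j)) ≠ p → 16 * σ ≤ ‖ξ j s₀ - ξ p s₀‖ :=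
    fun j hj p hp h ↦ le_norm_sub_of_rep_ne hσ hgap hj hp h
  have hisoS : ∀ i ∈ S, ∀ j ∉ S, (Finset.fold min (c₀ * s₀) (fun pp ↦ ‖ξ (Prod.fst pp) s₀ - ξ (Prod.snd pp) s₀‖) (S ×ˢ Sᶜ)) ≤ ‖ξ i s₀ - ξ j s₀‖ := fun i hi j hj ↦ isol_le_norm_sub hi hj
  refine ⟨fun p hp ↦ ⟨hthr, ?_, admissible_window hlip hTs₀ hs hs' hRpS hclose hfar hisoS hσiso hσ hp⟩,
    fun p hp j ↦ mem_class_iff_inside hlip hTs₀ hs hs' hRpS hclose hfar hisoS hσiso hσ hp j,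
    fun p hp j hj ↦ mem_and_rep_eq_of_inside hlip hTs₀ hs hs' hRpS hclose hfar hisoS hσiso hσ hp hj,
    fun j hj p hp h ↦ norm_sub_centre_le_of_rep_eq hlip hTs₀ hs hs' hclose hj hp h⟩
  · -- cone
    have hp' : p ∈ S := hRpS hp
    refine cone_window hκ hκ1 (hT0.trans hTs₀) hs (hcone p s₀ hTs₀) hσiso ?_
    rw [hc₀]
    have := isol_le (ξ := ξ) (c₀ := c₀) (S := S) (s := s₀)
    rw [hc₀] at this
    exact this

/-- **THRESHOLD FOR THE MAIN COVERS**: with `ρ = c_ρ·gsc`, `0 ≤ c_ρ ≤ λ/4`, `0 ≤ c₀ ≤ 4`, a cover with floor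
`λ·isol s₀ ≤ σ` and ceiling `16σ ≤ isol s₀` is above the threshold at every `s ∈ [s₀, s₀ + σ/4]`. [folklore] -/
theorem threshold_main {ξ : Fin N → ℝ → E3} {T c₀ lam cρ : ℝ} {ρ : ℝ → ℝ}
    (hlip : ∀ i s s', T ≤ s → T ≤ s' → ‖ξ i s - ξ i s'‖ ≤ 2 * |s - s'|) (hc₀4 : c₀ ≤ 4)
    (hcρ0 : 0 ≤ cρ) (hcρl : cρ ≤ lam / 4) (hρ : ∀ s, ρ s = cρ * (Finset.fold min (c₀ * s) (fun pp ↦ ‖ξ (Prod.fst pp) s - ξ (Prod.snd pp) s‖) (Finset.offDiag Finset.univ)))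
    {S : Finset (Fin N)} {s₀ s σ : ℝ} (hTs₀ : T ≤ s₀) (hs : s₀ ≤ s) (hs' : s ≤ s₀ + σ / 4) (hσ : 0 < σ)
    (hσiso : 16 * σ ≤ (Finset.fold min (c₀ * s₀) (fun pp ↦ ‖ξ (Prod.fst pp) s₀ - ξ (Prod.snd pp) s₀‖) (S ×ˢ Sᶜ))) (hlamσ : lam * (Finset.fold min (c₀ * s₀) (fun pp ↦ ‖ξ (Prod.fst pp) s₀ - ξ (Prod.snd pp) s₀‖) (S ×ˢ Sᶜ)) ≤ σ) : ρ s ≤ 1 / 8 * (4 * σ) :=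
  threshold_window (gs := fun s ↦ (Finset.fold min (c₀ * s) (fun pp ↦ ‖ξ (Prod.fst pp) s - ξ (Prod.snd pp) s‖) (Finset.offDiag Finset.univ))) (isoS := (Finset.fold min (c₀ * s) (fun pp ↦ ‖ξ (Prod.fst pp) s - ξ (Prod.snd pp) s‖) (S ×ˢ Sᶜ))) (isoS₀ := (Finset.fold min (c₀ * s₀) (fun pp ↦ ‖ξ (Prod.fst pp) s₀ - ξ (Prod.snd pp) s₀‖) (S ×ˢ Sᶜ))) (hρ s)
    hcρ0 hcρl gsc_le_isol (isol_le_isol_add hs hc₀4 fun i ↦ hlip i s₀ s hTs₀ (hTs₀.trans hs)) hs' hσiso hlamσ hσ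

/-- **THRESHOLD FOR THE REFINEMENT** at the switch time `s₁ = s₀ + σ/4`: with `c_ρ ≤ λ²/4`, old floor
`λ·isol s₀ ≤ σ`, new floor `λ·isol s₁ ≤ σ₁`, refinement floor `λ·min σ σ₁ ≤ σ_r`, `0 < λ ≤ 1` and the upper
one-sided Lipschitz bound `isol s₁ ≤ isol s₀ + σ`: `ρ s₁ ≤ (1/8)·(4σ_r)`. [folklore] -/
theorem threshold_refinement {ξ : Fin N → ℝ → E3} {c₀ lam cρ : ℝ} {ρ : ℝ → ℝ}
    (hcρ0 : 0 ≤ cρ) (hcρl : cρ ≤ lam ^ 2 / 4) (hρ : ∀ s, ρ s = cρ * (Finset.fold min (c₀ * s) (fun pp ↦ ‖ξ (Prod.fst pp) s - ξ (Prod.snd pp) s‖) (Finset.offDiag Finset.univ))) (hlam0 : 0 < lam) (hlam1 : lam ≤ 1)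
    {S : Finset (Fin N)} {s₀ s₁ σ σ₁ σr : ℝ}
    (hlamσ : lam * (Finset.fold min (c₀ * s₀) (fun pp ↦ ‖ξ (Prod.fst pp) s₀ - ξ (Prod.snd pp) s₀‖) (S ×ˢ Sᶜ)) ≤ σ) (hlamσ₁ : lam * (Finset.fold min (c₀ * s₁) (fun pp ↦ ‖ξ (Prod.fst pp) s₁ - ξ (Prod.snd pp) s₁‖) (S ×ˢ Sᶜ)) ≤ σ₁) (hlamσr : lam * min σ σ₁ ≤ σr)
    (hup : (Finset.fold min (c₀ * s₁) (fun pp ↦ ‖ξ (Prod.fst pp) s₁ - ξ (Prod.snd pp) s₁‖) (S ×ˢ Sᶜ)) ≤ (Finset.fold min (c₀ * s₀) (fun pp ↦ ‖ξ (Prod.fst pp) s₀ - ξ (Prod.snd pp) s₀‖) (S ×ˢ Sᶜ)) + σ) (hiso₁ : 0 ≤ (Finset.fold min (c₀ * s₁) (fun pp ↦ ‖ξ (Prod.fst pp) s₁ - ξ (Prod.snd pp) s₁‖) (S ×ˢ Sᶜ))) :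
    ρ s₁ ≤ 1 / 8 * (4 * σr) := by
  rw [hρ]
  have h1 : (Finset.fold min (c₀ * s₁) (fun pp ↦ ‖ξ (Prod.fst pp) s₁ - ξ (Prod.snd pp) s₁‖) (Finset.offDiag Finset.univ)) ≤ (Finset.fold min (c₀ * s₁) (fun pp ↦ ‖ξ (Prod.fst pp) s₁ - ξ (Prod.snd pp) s₁‖) (S ×ˢ Sᶜ)) := gsc_le_isol
  -- `λ·isol s₁ / 2 ≤ min σ σ₁`
  have h2 : lam * (Finset.fold min (c₀ * s₁) (fun pp ↦ ‖ξ (Prod.fst pp) s₁ - ξ (Prod.snd pp) s₁‖) (S ×ˢ Sᶜ)) / 2 ≤ σ := by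
    have e1 : lam * (Finset.fold min (c₀ * s₁) (fun pp ↦ ‖ξ (Prod.fst pp) s₁ - ξ (Prod.snd pp) s₁‖) (S ×ˢ Sᶜ)) ≤ lam * ((Finset.fold min (c₀ * s₀) (fun pp ↦ ‖ξ (Prod.fst pp) s₀ - ξ (Prod.snd pp) s₀‖) (S ×ˢ Sᶜ)) + σ) := mul_le_mul_of_nonneg_left hup hlam0.le
    have e2 : lam * σ ≤ 1 * σ := by
      have hσ0 : 0 ≤ σ := by
        have := hlamσ; have : 0 ≤ lam * (Finset.fold min (c₀ * s₁) (fun pp ↦ ‖ξ (Prod.fst pp) s₁ - ξ (Prod.snd pp) s₁‖) (S ×ˢ Sᶜ)) := mul_nonneg hlam0.le hiso₁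
        nlinarith
      exact mul_le_mul_of_nonneg_right hlam1 hσ0
    nlinarith
  have h3 : lam * (Finset.fold min (c₀ * s₁) (fun pp ↦ ‖ξ (Prod.fst pp) s₁ - ξ (Prod.snd pp) s₁‖) (S ×ˢ Sᶜ)) / 2 ≤ min σ σ₁ := le_min h2 (by nlinarith)
  have h4 : lam * (lam * (Finset.fold min (c₀ * s₁) (fun pp ↦ ‖ξ (Prod.fst pp) s₁ - ξ (Prod.snd pp) s₁‖) (S ×ˢ Sᶜ)) / 2) ≤ σr := (mul_le_mul_of_nonneg_left h3 hlam0.le).trans hlamσr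
  calc cρ * (Finset.fold min (c₀ * s₁) (fun pp ↦ ‖ξ (Prod.fst pp) s₁ - ξ (Prod.snd pp) s₁‖) (Finset.offDiag Finset.univ)) ≤ cρ * (Finset.fold min (c₀ * s₁) (fun pp ↦ ‖ξ (Prod.fst pp) s₁ - ξ (Prod.snd pp) s₁‖) (S ×ˢ Sᶜ)) := mul_le_mul_of_nonneg_left h1 hcρ0
    _ ≤ lam ^ 2 / 4 * (Finset.fold min (c₀ * s₁) (fun pp ↦ ‖ξ (Prod.fst pp) s₁ - ξ (Prod.snd pp) s₁‖) (S ×ˢ Sᶜ)) := mul_le_mul_of_nonneg_right hcρl hiso₁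
    _ = (lam * (lam * (Finset.fold min (c₀ * s₁) (fun pp ↦ ‖ξ (Prod.fst pp) s₁ - ξ (Prod.snd pp) s₁‖) (S ×ˢ Sᶜ)) / 2)) / 2 := by ring
    _ ≤ σr / 2 := by linarith
    _ = 1 / 8 * (4 * σr) := by ring

/-! ### The error envelope -/

/-- **ENVELOPE OF A NULL SEQUENCE.** If `ζ → 0` then there are a time `T_Z` and a function `Z ≥ 0` with `Z → 0`
such that `max (ζ s) 0 ≤ Z t` whenever `T_Z ≤ t ≤ s`. (`Z t = sup_{s ≥ max t T_Z} ζ⁺ s`.) [folklore] -/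
theorem exists_envelope {ζ : ℝ → ℝ} (hζ : Tendsto ζ atTop (𝓝 0)) :
    ∃ (T_Z : ℝ) (Z : ℝ → ℝ), Tendsto Z atTop (𝓝 0) ∧ (∀ t, 0 ≤ Z t) ∧
      ∀ t s, T_Z ≤ t → t ≤ s → max (ζ s) 0 ≤ Z t := by
  have hζp : Tendsto (fun s ↦ max (ζ s) 0) atTop (𝓝 0) := by
    have := hζ.max (tendsto_const_nhds (x := (0 : ℝ)))
    simpa using this
  obtain ⟨T_Z, hT⟩ := (hζp.eventually (ge_mem_nhds one_pos)).exists_forall_of_atTop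
  have hne : ∀ t, ((fun s ↦ max (ζ s) 0) '' Set.Ici (max t T_Z)).Nonempty := fun t ↦
    ⟨_, _, Set.self_mem_Ici, rfl⟩
  have hnn : ∀ t, 0 ≤ sSup ((fun s ↦ max (ζ s) 0) '' Set.Ici (max t T_Z)) := fun t ↦
    Real.sSup_nonneg (by rintro _ ⟨s, -, rfl⟩; exact le_max_right _ _)
  refine ⟨T_Z, fun t ↦ sSup ((fun s ↦ max (ζ s) 0) '' Set.Ici (max t T_Z)), ?_, hnn, fun t s ht hts ↦ ?_⟩
  · -- tends to zero
    refine Metric.tendsto_atTop.mpr fun ε hε ↦ ?_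
    obtain ⟨T₁, hT₁⟩ := (hζp.eventually (gt_mem_nhds (half_pos hε))).exists_forall_of_atTop
    refine ⟨T₁, fun t ht ↦ ?_⟩
    rw [Real.dist_eq, sub_zero, abs_lt]
    refine ⟨by linarith [hnn t], lt_of_le_of_lt (csSup_le (hne t) ?_) (half_lt_self hε)⟩
    rintro _ ⟨s, hs, rfl⟩
    exact (hT₁ s (ht.trans ((le_max_left _ _).trans hs))).le
  · -- the tail bound
    refine le_csSup ⟨1, ?_⟩ ⟨s, Set.mem_Ici.mpr (max_le hts (ht.trans hts)), rfl⟩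
    rintro _ ⟨s', hs', rfl⟩
    exact hT s' ((le_max_right _ _).trans hs')

/-! ### The flux integrand along a step -/

/-- `x^{3/2} = x·√x` for `x ≥ 0`. [folklore] -/
private theorem rpow_three_halves {x : ℝ} (hx : 0 ≤ x) : x ^ (3 / 2 : ℝ) = x * √x := by
  rw [Real.sqrt_eq_rpow, show (3 / 2 : ℝ) = 1 + 1 / 2 by norm_num, Real.rpow_add' hx (by norm_num),
    Real.rpow_one]

/-- **LOWER RIEMANN BOUND OF THE FLUX INTEGRAND OVER A STEP.** If `f ≥ ((Aσ)^{3/2})⁻¹` on `[s₀, s]` and `f` is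
interval-integrable there then `(s − s₀)·(Aσ·√(Aσ))⁻¹ ≤ ∫_{s₀}^{s} f`. [folklore] -/
theorem integral_lower {f : ℝ → ℝ} {s₀ s A σ : ℝ} (hs : s₀ ≤ s) (hAσ : 0 < A * σ)
    (hf : IntervalIntegrable f volume s₀ s) (hlow : ∀ s' ∈ Set.Icc s₀ s, ((A * σ) ^ (3 / 2 : ℝ))⁻¹ ≤ f s') :
    (s - s₀) * (A * σ * √(A * σ))⁻¹ ≤ ∫ s' in s₀..s, f s' := by
  have h := intervalIntegral.integral_mono_on hs intervalIntegrable_const hf hlow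
  rw [intervalIntegral.integral_const, smul_eq_mul, rpow_three_halves hAσ.le] at h
  exact h

/-- **STATIC COST ≤ MULTIPLE OF THE STEP INTEGRAL**: `(s − s₀)·((4σ)^{3/2})⁻¹ ≤ A√A · [(s − s₀)(Aσ√(Aσ))⁻¹]`
for `A ≥ 1`. [folklore] -/
theorem static_le_integral {s₀ s A σ : ℝ} (hs : s₀ ≤ s) (hA : 1 ≤ A) (hσ : 0 < σ) :
    (s - s₀) * ((4 * σ) ^ (3 / 2 : ℝ))⁻¹ ≤ A * √A * ((s - s₀) * (A * σ * √(A * σ))⁻¹) := by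
  have hA0 : 0 < A := by linarith
  have hsqA : 0 < √A := Real.sqrt_pos.mpr hA0
  have hsqσ : 0 < √σ := Real.sqrt_pos.mpr hσ
  rw [Real.sqrt_mul hA0.le, rpow_three_halves (by linarith), Real.sqrt_mul (by norm_num : (0:ℝ) ≤ 4),
    show √(4 : ℝ) = 2 by rw [show (4:ℝ) = 2 ^ 2 by norm_num, Real.sqrt_sq (by norm_num)]]
  have key : A * √A * ((s - s₀) * (A * σ * (√A * √σ))⁻¹) = (s - s₀) * (σ * √σ)⁻¹ := by
    field_simp
  rw [key]
  apply mul_le_mul_of_nonneg_left _ (by linarith)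
  rw [inv_le_inv₀ (by positivity) (by positivity)]
  nlinarith [mul_pos hσ hsqσ]

/-- **SWITCH COST ≤ MULTIPLE OF THE STEP INTEGRAL** (full step `s − s₀ = σ/4`, refinement scale
`σ_r ≥ λ²σ`): `(√(4σ_r))⁻¹ ≤ (2A√A/λ) · [(s − s₀)(Aσ√(Aσ))⁻¹]`. [folklore] -/
theorem switch_le_integral {s₀ s A σ σr lam : ℝ} (hs : s - s₀ = σ / 4) (hA : 1 ≤ A) (hσ : 0 < σ)
    (hlam : 0 < lam) (hσr : lam ^ 2 * σ ≤ σr) :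
    (√(4 * σr))⁻¹ ≤ 2 * A * √A / lam * ((s - s₀) * (A * σ * √(A * σ))⁻¹) := by
  have hA0 : 0 < A := by linarith
  have hsqA : 0 < √A := Real.sqrt_pos.mpr hA0
  have hsqσ : 0 < √σ := Real.sqrt_pos.mpr hσ
  have hσr0 : 0 < σr := lt_of_lt_of_le (by positivity) hσr
  rw [Real.sqrt_mul hA0.le, hs]
  have key : 2 * A * √A / lam * (σ / 4 * (A * σ * (√A * √σ))⁻¹) = (2 * lam * √σ)⁻¹ := by
    field_simp
    norm_num
  rw [key, inv_le_inv₀ (Real.sqrt_pos.mpr (by positivity)) (by positivity)]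
  -- `2 λ √σ ≤ √(4 σ_r)`
  have h1 : 2 * lam * √σ = √(4 * (lam ^ 2 * σ)) := by
    rw [Real.sqrt_mul (by norm_num), Real.sqrt_mul (by positivity), Real.sqrt_sq hlam.le,
      show √(4 : ℝ) = 2 by rw [show (4:ℝ) = 2 ^ 2 by norm_num, Real.sqrt_sq (by norm_num)]]
    ring
  rw [h1]
  exact Real.sqrt_le_sqrt (by linarith)

/-- **THE FLUX INTEGRAND DOMINATES `((Aσ)^{3/2})⁻¹` ON A STEP** (`A = 2/(λc₀)`): for `s' ∈ [s₀, s]`,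
`s − s₀ ≤ σ/4`, `16σ ≤ isol s₀`, `λ·isol s₀ ≤ σ`, the one-sided Lipschitz bound, `r s' ≤` every member/outsider
distance, `0 < r s'`, `0 < c₀ ≤ 1`: `((Aσ)^{3/2})⁻¹ ≤ ((min (r s') s')^{3/2})⁻¹`. [folklore] -/
theorem integrand_lower {ξ : Fin N → ℝ → E3} {S : Finset (Fin N)} {r : ℝ → ℝ} {s₀ s' σ lam c₀ A : ℝ}
    (hc₀ : 0 < c₀) (hc₀1 : c₀ ≤ 1) (hlam : 0 < lam) (hA : A = 2 / (lam * c₀)) (hσ : 0 < σ)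
    (hs₀ : s₀ ≤ s') (hs' : s' ≤ s₀ + σ / 4) (hσiso : 16 * σ ≤ (Finset.fold min (c₀ * s₀) (fun pp ↦ ‖ξ (Prod.fst pp) s₀ - ξ (Prod.snd pp) s₀‖) (S ×ˢ Sᶜ))) (hlamσ : lam * (Finset.fold min (c₀ * s₀) (fun pp ↦ ‖ξ (Prod.fst pp) s₀ - ξ (Prod.snd pp) s₀‖) (S ×ˢ Sᶜ)) ≤ σ)
    (hlipiso : (Finset.fold min (c₀ * s') (fun pp ↦ ‖ξ (Prod.fst pp) s' - ξ (Prod.snd pp) s'‖) (S ×ˢ Sᶜ)) ≤ (Finset.fold min (c₀ * s₀) (fun pp ↦ ‖ξ (Prod.fst pp) s₀ - ξ (Prod.snd pp) s₀‖) (S ×ˢ Sᶜ)) + 4 * (s' - s₀)) (hr : 0 < r s')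
    (hrS : ∀ i ∈ S, ∀ j ∉ S, r s' ≤ ‖ξ i s' - ξ j s'‖) :
    ((A * σ) ^ (3 / 2 : ℝ))⁻¹ ≤ ((min (r s') s') ^ (3 / 2 : ℝ))⁻¹ := by
  -- `0 < s'`: `s' ≥ s₀` and `16σ ≤ isol s₀ ≤ c₀ s₀` force `s₀ > 0`
  have hs₀pos : 0 < s₀ := by
    have h1 : (Finset.fold min (c₀ * s₀) (fun pp ↦ ‖ξ (Prod.fst pp) s₀ - ξ (Prod.snd pp) s₀‖) (S ×ˢ Sᶜ)) ≤ c₀ * s₀ := isol_le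
    by_contra h
    push Not at h
    have : c₀ * s₀ ≤ 0 := mul_nonpos_of_nonneg_of_nonpos hc₀.le h
    linarith
  have hmin : 0 < min (r s') s' := lt_min hr (by linarith)
  -- `c₀ · min (r s') s' ≤ isol s' ≤ 2 isol s₀ ≤ 2σ/λ`
  have h3 : c₀ * min (r s') s' ≤ (Finset.fold min (c₀ * s') (fun pp ↦ ‖ξ (Prod.fst pp) s' - ξ (Prod.snd pp) s'‖) (S ×ˢ Sᶜ)) := by
    rw [le_isol_iff]
    constructor
    · exact mul_le_mul_of_nonneg_left (min_le_right _ _) hc₀.le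
    · intro i hi j hj
      calc c₀ * min (r s') s' ≤ 1 * r s' := by
            apply mul_le_mul hc₀1 (min_le_left _ _) hmin.le zero_le_one
        _ = r s' := one_mul _
        _ ≤ _ := hrS i hi j hj
  have h4 : (Finset.fold min (c₀ * s') (fun pp ↦ ‖ξ (Prod.fst pp) s' - ξ (Prod.snd pp) s'‖) (S ×ˢ Sᶜ)) ≤ 2 * σ / lam := by
    have : (Finset.fold min (c₀ * s₀) (fun pp ↦ ‖ξ (Prod.fst pp) s₀ - ξ (Prod.snd pp) s₀‖) (S ×ˢ Sᶜ)) ≤ σ / lam := by rw [le_div_iff₀ hlam]; linarith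
    have : (Finset.fold min (c₀ * s') (fun pp ↦ ‖ξ (Prod.fst pp) s' - ξ (Prod.snd pp) s'‖) (S ×ˢ Sᶜ)) ≤ 2 * (Finset.fold min (c₀ * s₀) (fun pp ↦ ‖ξ (Prod.fst pp) s₀ - ξ (Prod.snd pp) s₀‖) (S ×ˢ Sᶜ)) := by linarith
    rw [le_div_iff₀ hlam]
    rw [le_div_iff₀ hlam] at *
    nlinarith
  have h5 : min (r s') s' ≤ A * σ := by
    rw [hA]
    rw [div_mul_eq_mul_div, le_div_iff₀ (by positivity)]
    calc min (r s') s' * (lam * c₀) = lam * (c₀ * min (r s') s') := by ring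
      _ ≤ lam * (2 * σ / lam) := by apply mul_le_mul_of_nonneg_left (h3.trans h4) hlam.le
      _ = 2 * σ := by field_simp
  have hAσ : 0 < A * σ := lt_of_lt_of_le hmin h5
  rw [inv_le_inv₀ (by positivity) (by positivity)]
  exact Real.rpow_le_rpow hmin.le h5 (by norm_num)

/-- Registered one-line form (carrier `rpow_three_halves_sce12` of the crux item) of `rpow_three_halves`. [folklore] -/
theorem rpow_three_halves_sce12 : ∀ (x : ℝ), 0 ≤ x → x ^ (3 / 2 : ℝ) = x * √x :=
  fun _ hx ↦ rpow_three_halves hx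

end Summit.FinalStateConjecture.FinalStateConjecture.Theorems.SublinearIsFree.Staircase

end
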